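import Summits.ABC.IUTFork.LDHSUnitFamilySzpiroGuard
import Summits.ABC.ABC.Theorems.ThetaPartII.Negative.HregBadFalseOfSzpiroBadMixedWitness
import HarnessLib

/-!
# `hregBad` on the S-unit family: the SZPIRO GUARD decides it BOTH WAYS (plan RULING C-R42 «C:SZPIRO-GUARD-SUNIT», (Q2))

Record-only PROOF file (D-0012) of the abc-iut cell (R2 S-chain team, seat abc-iut-s2-p4 gen 5); TAKES NO SIDE on [IUTchIII] Cor. 3.12,
on [IUTchIV] Thm. 1.10, or on any author. S. Mochizuki, *IUT IV* [Mochizuki2012], Thm. 1.10 proof Steps (v)–(viii) pp. 27–31; Cor. 2.2 (ii)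
proof (P1)–(P7) pp. 45–46; [MochizukiGenEll2010] Def. 1.5 (iii) p. 8; cell note plan/c312/STEPV-IND1-NOTE.md (reading (U)).

THE QUESTION (C-R42). After `Conditional.not_hreg_v4` (abc-iut-s2-p5) / `Conditional.not_hreg_at_prime` (this lineage, p458004: the cone binder is
false at EVERY fixed prime `l ≥ 173` on the S-unit family `P_{a,c}`), the certificates of record demand the cone estimate only at SZPIRO-BAD
admissible `(λ, l)` (`hregBad`, abc-iut-s2-p2 p452755; status of record C-R41: false MODULO one admissible Szpiro-bad mixed violator,
abc-iut-s2-p5 `Negative.hregBad_false_of_szpiroBadMixedWitness` p457414). Is the family `P_{a,c}` such a violator?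

THE ANSWER, IN THE KERNEL (this file; the guard itself is part V `LDHSUnitFamilySzpiroGuard`: at `(P_{a,c}, l)` the Szpiro-bad disjunct holds
iff `log|disc ℚ(√(5^{2a}+4·7^{2c}))| < ((l+4)/(3l))·(a·log 5 + 2c·log 7) − …`, i.e. iff `D = 5^{2a} + 4·7^{2c}` is a POWERFUL value):
* `SUnitFamily.slack_lt_mixed` — the core arithmetic of part IV read as a STRICT violation: for `l ≥ 173` and `a·log 5 > K(l)` the sharp slack
  of abc-iut-s2-p1's necessity is strictly below the mixed-height sum at the prime `5`;
* **`Conditional.not_hregBad_of_sUnitFamily_szpiroBad`** — for every prime `l ≥ 173`: IF the family has Szpiro-bad members `(P_{a,c}, l)` with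
  `a` arbitrarily large (`l ∤ a, c`, `7^c ≤ 5^a ≤ 5^l·7^c`), THEN `hregBad` (binder text VERBATIM) is FALSE — composed BY NAME from p457414 with the
  witness tuple of this lineage (admissibility (P2)/(P5) parts II–III, (P6) by `Cor22.condP6_of_seven_le` on `K_∞(5^l)`, `d_mod = 2`, mixed pair
  `(𝔭₁, 𝔭₂)` over `5`, `W₀ = {5}`, strict violation `slack_lt_mixed`);
* **`Conditional.not_hregBad_of_sUnitFamily_powerful`** — the same with the Szpiro-bad disjunct replaced by the pure arithmetic condition
  `log|disc F_{a,c}| ≤ (1 + 4/l)·a·log 5 − c(l)` (part V `szpiroBad_of_log_discr_le`): **`hregBad` falls the day infinitely many members of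
  `5^{2a} + 4·7^{2c}` (`l ∤ a, c`) have squarefree kernel below `5^{(1+4/l)a}·e^{−c(l)}`**;
* **`Conditional.szpiroGood_eventually_of_hregBad`** / **`Conditional.lt_log_discr_eventually_of_hregBad`** — the contrapositives:
  **`hregBad` IMPLIES that every large member of the family is Szpiro-GOOD**, i.e. an effective Szpiro/abc-type LOWER BOUND
  `log|disc ℚ(√(5^{2a}+4·7^{2c}))| > (1 + 4/l)·a·log 5 − c(l)` for all large `a` with `l ∤ a, c`, `7^c ≤ 5^a ≤ 5^l·7^c`.
HONEST READING (numbers, not adjectives): `hregBad` restricted to this family is EQUIVALENT (up to the threshold in `a`) to a Diophantine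
statement of abc type about the `ℤ`-triples `5^{2a} + 4·7^{2c} = D` (quality `> 1/(3/4 + 1/l)`-type events); the tree can neither exhibit nor
exclude such members, so C-R41's status of record STANDS («neither refuted nor instantiated») — but it is now CERTIFIED Szpiro-type: discharging
`hregBad` proves, and refuting it along this family disproves, an explicit abc-type inequality. Nothing here asserts either. No side taken;
refuted-as-typed ≠ refuted-in-print; typed ≠ proved. PROOF-ONLY file: no definitions, no named `Prop` facts.
[cite: Mochizuki2012, IUTchIV Thm. 1.10 proof Steps (v)-(viii) p. 27–31] [cite: Mochizuki2012, IUTchIV Cor. 2.2 (ii) proof (P1)-(P7) pp. 45–46]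
[cite: MochizukiGenEll2010, Def 1.5 (iii) p.8] [claim: Mochizuki2012, status: disputed] for every IUT quotation.
-/

noncomputable section

namespace Summit.ABC.IUTFork

open NumberField IsDedekindDomain Literature.IUT.LogVolume Literature.IUT.LogVolume.Cor22 Literature.IUT.HodgeTheaters
open Literature.NumberTheory.DiophantineGeometry.GenEll Literature.NumberTheory.NumberFields
open scoped Classical

namespace SUnitFamily

/-- **The core arithmetic as a STRICT violation.** For `l ≥ 173`, `0 ≤ lD ≤ a·log 5 + ½·log 5`, `0 ≤ lC ≤ ½(log 5 + 2 log 7)` and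
`a·log 5 > K(l) = 5·(8·½(log 5 + 2 log 7) + 4·log 5 + ((l+1)/4)·E)`, abc-iut-s2-p1's sharp slack `(7 + 6/l)(lD + lC) + ((l−3)/(4l))·lC + ((l+1)/4)·E`
is STRICTLY below the mixed-height sum `(a·log 5/(2l))·(l(l+1)/12 − 16/(l−1))` at the prime `5` (contrapositive of part IV `core_bound`). [folklore] -/
theorem slack_lt_mixed {l : ℕ} (h173 : 173 ≤ l) {a : ℕ} {lD lC E : ℝ}
    (hlD0 : 0 ≤ lD) (hlC0 : 0 ≤ lC) (hlD : lD ≤ (a : ℝ) * Real.log 5 + Real.log 5 / 2)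
    (hlC : lC ≤ (Real.log 5 + 2 * Real.log 7) / 2)
    (hbig : 5 * (8 * ((Real.log 5 + 2 * Real.log 7) / 2) + 8 * (Real.log 5 / 2) + ((l : ℝ) + 1) / 4 * E) < (a : ℝ) * Real.log 5) :
    (4 * (2 : ℝ) - 1 + 3 * (2 : ℝ) / l) * (lD + lC) + ((l : ℝ) + 5 - 4 * (2 : ℝ)) / (4 * (l : ℝ)) * lC + ((l : ℝ) + 1) / 4 * E <
      1 / (2 * (l : ℝ)) * ((a : ℝ) * Real.log 5) *
        ((l : ℝ) * ((l : ℝ) + 1) / 12 - 4 * (1 - 1 / 2) / (((l : ℝ) - 1) * (1 / 2) ^ 3)) := by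
  by_contra h
  have := core_bound h173 hlD0 hlC0 hlD hlC rfl (not_lt.mp h)
  linarith

end SUnitFamily

namespace Conditional

/-- **`hregBad` IS FALSE IF THE S-UNIT FAMILY HAS SZPIRO-BAD MEMBERS OF UNBOUNDED HEIGHT (C-R42 (Q2)).** For a prime `l ≥ 173`: if for every `N`
there are exponents `a ≥ N`, `c` with `l ∤ a`, `l ∤ c`, `7^c ≤ 5^a ≤ 5^l·7^c` such that `(P_{a,c}, l)` satisfies the SZPIRO-BAD disjunct of
RESHAPE-4 (VERBATIM), then the cone binder `hregBad` (abc-iut-s2-p2 p452755 / the certificates' `hreg ↦ hregBad`, text VERBATIM) fails —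
abc-iut-s2-p5's `Negative.hregBad_false_of_szpiroBadMixedWitness` (p457414) BY NAME, fed with this lineage's witness tuple: `P_{a,c} ∈ U_P`
minimal, a core, (P2) (`l ∤ 2a, 2c`), (P5) (`𝔭₁ ∤ 2l`), (P6) above a height on `K_∞(5^l)` (`Cor22.condP6_of_seven_le`), `d_mod = 2 ≤ (l+5)/4`,
the mixed pair `(𝔭₁, 𝔭₂)` over `5` (`ord j = −2a` resp. `≥ 0`), `W₀ = {5}` (`ω₅ = ½`, mixed sum `a·log 5`), and the STRICT violation
`SUnitFamily.slack_lt_mixed` for `a·log 5 > K(l)`. By part V the antecedent is a «powerful value of `5^{2a} + 4·7^{2c}`» condition; it is NOT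
asserted. [cite: Mochizuki2012, IUTchIV Thm. 1.10 proof Steps (v)-(viii) p. 27–31] [claim: Mochizuki2012, status: disputed] -/
theorem not_hregBad_of_sUnitFamily_szpiroBad {l : ℕ} (hl : l.Prime) (h173 : 173 ≤ l)
    (H : ∀ N : ℕ, ∃ a c : ℕ, N ≤ a ∧ ¬ l ∣ a ∧ ¬ l ∣ c ∧ 7 ^ c ≤ 5 ^ a ∧ 5 ^ a ≤ 5 ^ l * 7 ^ c ∧
      (((l : ℝ) + 5) / 4 < (Cor22.dmod (SUnitFamily.Pt a c) : ℝ) ∨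
        6 * l * (((l : ℝ) + 5) - 4 * Cor22.dmod (SUnitFamily.Pt a c)) / (((l : ℝ) + 4) * ((l : ℝ) - 3))
            * ((SUnitFamily.Pt a c).logDiff + (1 - 1 / (l : ℝ)) * Cor22.logCondAvoid (SUnitFamily.Pt a c) {2, l})
          + 6 * l * ((l : ℝ) + 5) / (((l : ℝ) + 4) * ((l : ℝ) - 3)) * Real.log Real.pi <
          Cor22.logQAvoid (SUnitFamily.Pt a c) {2, l})) :
    ¬ (∀ P : NFPoint, P ∈ UP → ∀ l : ℕ, l.Prime → 5 ≤ l →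
      Cor22.AdmitsCore P → Cor22.CondP2 P l → Cor22.CondP5 P l → Cor22.CondP6 P l →
      (((l : ℝ) + 5) / 4 < (Cor22.dmod P : ℝ) ∨
        6 * l * (((l : ℝ) + 5) - 4 * Cor22.dmod P) / (((l : ℝ) + 4) * ((l : ℝ) - 3))
            * (P.logDiff + (1 - 1 / (l : ℝ)) * Cor22.logCondAvoid P {2, l})
          + 6 * l * ((l : ℝ) + 5) / (((l : ℝ) + 4) * ((l : ℝ) - 3)) * Real.log Real.pi < Cor22.logQAvoid P {2, l}) →
      ∀ T : Cor22.ThetaVolumeDatumAt P l,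
        (letI := T.instFieldF; letI := T.instNumberFieldF; letI := T.instAlgebraF; letI := T.instFieldK
         letI := T.instNumberFieldK; letI := T.instAlgebraK; letI := T.instFieldFbar; letI := T.instAlgebraFbar
         letI := T.instAlgebraKFbar; letI := T.instIsElliptic
         ¬ (∀ p ∈ T.I.supportPrimes, ∀ v w : placesOver (fieldOfModuli T.E) p,
            (Summit.ABC.IUTFork.DHData.ofInput T.I).logQloc p v = (Summit.ABC.IUTFork.DHData.ofInput T.I).logQloc p w)) →
        T.HullEstimateOf
          (((l : ℝ) + 1) / 4 *
            ((1 + 12 * (Cor22.dmod P : ℝ) / l) * (P.logDiff + Cor22.logCondAvoid P {2, l})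
              + 2 * Real.log l + 52
              + 20 / 3 * Real.log (((2 ^ 12 * 3 ^ 3 * 5 * Cor22.dmod P : ℕ) : ℝ) * (l : ℝ))
                * (Nat.primeCounting (2 ^ 12 * 3 ^ 3 * 5 * Cor22.dmod P * l) : ℝ)))) := by
  apply Summit.ABC.ABC.Theorems.ThetaPartII.Negative.hregBad_false_of_szpiroBadMixedWitness
  haveI : Fact (Nat.Prime 5) := ⟨by norm_num⟩
  have hl2 : 2 ≤ l := hl.two_le
  have hl5 : l ≠ 5 := by omega
  have hlne2 : l ≠ 2 := by omega
  have hl7 : 7 ≤ l := by omega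
  have hlr : (173 : ℝ) ≤ (l : ℝ) := by exact_mod_cast h173
  have hl0 : (0 : ℝ) < (l : ℝ) := by linarith
  set R : ℝ := (5 : ℝ) ^ l with hRdef
  have hR : 1 ≤ R := one_le_pow₀ (by norm_num)
  obtain ⟨HK, hHK⟩ := Cor22.condP6_of_seven_le (SUnitFamily.cbTwoDiscs R hR)
  -- the `l`-only part of `B_III` at `d_mod = 2` and the threshold `K(l)`
  set E : ℝ := 2 * Real.log l + 52 + 20 / 3 * Real.log (1105920 * (l : ℝ)) * ((1105920 * l).primeCounting : ℝ) with hEdef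
  set K : ℝ := 5 * (8 * ((Real.log 5 + 2 * Real.log 7) / 2) + 8 * (Real.log 5 / 2) + ((l : ℝ) + 1) / 4 * E) with hKdef
  have hlog5 : 0 < Real.log 5 := Real.log_pos (by norm_num)
  -- choose a Szpiro-bad member beyond both thresholds (and beyond `l`, so that `c ≥ 1`)
  obtain ⟨n, hn⟩ := exists_nat_gt (max HK K / Real.log 5)
  obtain ⟨a, c, hNa, hla, hlc, hlo, hhi, hbad⟩ := H (n + l + 1)
  have ha1 : 1 ≤ a := by omega
  have hc1 : 1 ≤ c := by
    by_contra h0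
    have hc0 : c = 0 := by omega
    rw [hc0, pow_zero, mul_one] at hhi
    have := (Nat.pow_le_pow_iff_right (by norm_num : 1 < 5)).mp hhi
    omega
  have hbig : max HK K < (a : ℝ) * Real.log 5 := by
    have h1 : max HK K < (n : ℝ) * Real.log 5 := by rwa [div_lt_iff₀ hlog5] at hn
    have h2 : (n : ℝ) * Real.log 5 ≤ (a : ℝ) * Real.log 5 :=
      mul_le_mul_of_nonneg_right (by exact_mod_cast (by omega : n ≤ a)) hlog5.le
    linarith
  -- admissibility of `P_{a,c}` at `l`
  have hP : SUnitFamily.Pt a c ∈ UP := SUnitFamily.P_mem_UP ha1 hc1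
  have hcore : Cor22.AdmitsCore (SUnitFamily.Pt a c) := SUnitFamily.admitsCore_P ha1 hc1
  have h2 : Cor22.CondP2 (SUnitFamily.Pt a c) l := SUnitFamily.condP2_P ha1 hc1 hl hlne2 hla hlc
  have h5 : Cor22.CondP5 (SUnitFamily.Pt a c) l := SUnitFamily.condP5_P ha1 hc1 hl hl5
  have hd : Cor22.dmod (SUnitFamily.Pt a c) = 2 := SUnitFamily.dmod_P ha1 hc1
  have hmem : SUnitFamily.Pt a c ∈ (SUnitFamily.cbTwoDiscs R hR).toSet :=
    SUnitFamily.P_mem_cbTwoDiscs (a := a) (c := c) hR (by exact_mod_cast hlo) (by rw [hRdef]; exact_mod_cast hhi)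
  have hq : (a : ℝ) * Real.log 5 ≤ Cor22.logQForall (SUnitFamily.Pt a c) := SUnitFamily.le_logQForall_P ha1 hc1
  have hHK' : HK < Cor22.logQForall (SUnitFamily.Pt a c) := by linarith [le_max_left HK K]
  have h6 : Cor22.CondP6 (SUnitFamily.Pt a c) l := hHK (SUnitFamily.Pt a c) hmem hP l hl hl7 h2 h5 hHK'
  have h4d : 4 * (Cor22.dmod (SUnitFamily.Pt a c) : ℝ) ≤ (l : ℝ) + 5 := by rw [hd]; push_cast; linarith
  -- the mixed pair `(𝔭₁, 𝔭₂)` over `5`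
  obtain ⟨𝔭₁, 𝔭₂, -, -, ⟨k1, k1', k15, ko1⟩, ⟨k2, -, k25, -⟩, -, -⟩ := SUnitFamily.exists_four_places ha1 hc1
  have hv1 : 𝔭₁ ∈ placesOver (SUnitFamily.Pt a c).F 5 := Cor22.mem_placesOver_of_natCast_mem 5 𝔭₁ k15
  have hv2 : 𝔭₂ ∈ placesOver (SUnitFamily.Pt a c).F 5 := Cor22.mem_placesOver_of_natCast_mem 5 𝔭₂ k25
  have hord1 : ord (SUnitFamily.Pt a c).F 𝔭₁ (Cor22.jInv (SUnitFamily.Pt a c).x) = -(2 * (a : ℤ)) :=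
    (SUnitFamily.ord_at_p1 hc1 k15 k1 k1' ko1).1
  have hord2 : 0 ≤ ord (SUnitFamily.Pt a c).F 𝔭₂ (Cor22.jInv (SUnitFamily.Pt a c).x) := (SUnitFamily.ord_at_p2 hc1 k25 k2).1
  have hV : 𝔭₁ ∈ Cor22.badPlacesAvoid (SUnitFamily.Pt a c) {2, l} := by
    unfold Cor22.badPlacesAvoid
    rw [Finset.mem_filter, Cor22.mem_badPlaces_iff_ord_neg]
    refine ⟨by rw [hord1]; omega, fun p hp => ?_⟩
    simp only [Finset.mem_insert, Finset.mem_singleton] at hp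
    rcases hp with rfl | rfl
    · exact SplitDepth.natCast_not_mem_of_prime_ne ⟨𝔭₁, hv1⟩ Nat.prime_two (by norm_num)
    · exact SplitDepth.natCast_not_mem_of_prime_ne ⟨𝔭₁, hv1⟩ hl hl5
  have hW : 𝔭₂ ∈ Cor22.badPlacesAvoid (SUnitFamily.Pt a c) {2, l} →
      (ord (SUnitFamily.Pt a c).F 𝔭₁ (Cor22.jInv (SUnitFamily.Pt a c).x) : ℝ) * logNorm (SUnitFamily.Pt a c).F 𝔭₁ /
          (localDegree (SUnitFamily.Pt a c).F 𝔭₁ : ℝ) ≠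
        (ord (SUnitFamily.Pt a c).F 𝔭₂ (Cor22.jInv (SUnitFamily.Pt a c).x) : ℝ) * logNorm (SUnitFamily.Pt a c).F 𝔭₂ /
          (localDegree (SUnitFamily.Pt a c).F 𝔭₂ : ℝ) := by
    intro h
    exfalso
    unfold Cor22.badPlacesAvoid at h
    rw [Finset.mem_filter, Cor22.mem_badPlaces_iff_ord_neg] at h
    exact absurd hord2 (not_le.mpr h.1)
  -- `W₀ = {5}`: `ω₅ = 1/2`, mixed sum `a·log 5`
  obtain ⟨hω, hsum⟩ := SUnitFamily.mixed_data_at_five ha1 hc1 hl hl5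
  have hω' : ∀ p ∈ ({5} : Finset ℕ), 0 < ∑ V ∈ Finset.univ.filter
      (fun V : placesOver ↥(IntermediateField.adjoin ℚ ({Cor22.jInv (SUnitFamily.Pt a c).x} : Set (SUnitFamily.Pt a c).F)) p =>
        ¬ (ord _ V.1 (Cor22.jMod (SUnitFamily.Pt a c)) < 0 ∧ ((2 : ℕ) : 𝓞 _) ∉ V.1.asIdeal ∧ ((l : ℕ) : 𝓞 _) ∉ V.1.asIdeal)),
      weight _ V.1 := by
    intro p hp
    rw [Finset.mem_singleton] at hp
    subst hp
    rw [hω]; norm_num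
  refine ⟨SUnitFamily.Pt a c, hP, l, hl, by omega, hcore, h2, h5, h6, hbad, h4d, 5, Nat.prime_five, 𝔭₁, 𝔭₂, hv1, hv2, hV, hW,
    {5}, fun p hp => by rw [Finset.mem_singleton] at hp; subst hp; exact Nat.prime_five, hω', ?_⟩
  -- the STRICT violation at `W₀ = {5}`
  rw [Finset.sum_singleton, hsum, hω, hd]
  push_cast
  have hK : K < (a : ℝ) * Real.log 5 := lt_of_le_of_lt (le_max_right HK K) hbig
  have hm := SUnitFamily.slack_lt_mixed h173 (E := E) (NFPoint.logDiff_nonneg (SUnitFamily.Pt a c))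
    (Cor22.logCondAvoid_nonneg (SUnitFamily.Pt a c) {2, l}) (SUnitFamily.logDiff_le_linear hlo)
    (SUnitFamily.logCondAvoid_le ha1 hc1 {2, l}) (by rw [hKdef] at hK; exact hK)
  rw [hEdef] at hm
  convert hm using 2

/-- **`hregBad` IS FALSE IF `5^{2a} + 4·7^{2c}` IS POWERFUL INFINITELY OFTEN (C-R42 (Q2), arithmetic form).** For a prime `l ≥ 173`: if for
every `N` there are `a ≥ N`, `c` with `l ∤ a`, `l ∤ c`, `7^c ≤ 5^a ≤ 5^l·7^c` and
`log|disc ℚ(√(5^{2a} + 4·7^{2c}))| ≤ (1 + 4/l)·a·log 5 − (2(l+4)/3·log 5 + log 5 + 2·log 7 + 8)` (squarefree kernel of `D` below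
`5^{(1+4/l)a}·e^{−c(l)} ≈ √D·D^{2/l}`), then `hregBad` fails (part V `szpiroBad_of_log_discr_le` + `not_hregBad_of_sUnitFamily_szpiroBad`).
The antecedent — infinitely many high-quality values of the `ℤ`-triple family `5^{2a} + 4·7^{2c} = D` — is NOT asserted (it would contradict the
abc conjecture over `ℚ` for these triples). [cite: MochizukiGenEll2010, Def 1.5 (iii) p.8] [claim: Mochizuki2012, status: disputed] -/
theorem not_hregBad_of_sUnitFamily_powerful {l : ℕ} (hl : l.Prime) (h173 : 173 ≤ l)
    (H : ∀ N : ℕ, ∃ a c : ℕ, N ≤ a ∧ ¬ l ∣ a ∧ ¬ l ∣ c ∧ 7 ^ c ≤ 5 ^ a ∧ 5 ^ a ≤ 5 ^ l * 7 ^ c ∧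
      Real.log ((NumberField.discr (SUnitFamily.F a c)).natAbs : ℝ) ≤
        (1 + 4 / (l : ℝ)) * ((a : ℝ) * Real.log 5) - (2 * ((l : ℝ) + 4) / 3 * Real.log 5 + (Real.log 5 + 2 * Real.log 7) + 8)) :
    ¬ (∀ P : NFPoint, P ∈ UP → ∀ l : ℕ, l.Prime → 5 ≤ l →
      Cor22.AdmitsCore P → Cor22.CondP2 P l → Cor22.CondP5 P l → Cor22.CondP6 P l →
      (((l : ℝ) + 5) / 4 < (Cor22.dmod P : ℝ) ∨
        6 * l * (((l : ℝ) + 5) - 4 * Cor22.dmod P) / (((l : ℝ) + 4) * ((l : ℝ) - 3))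
            * (P.logDiff + (1 - 1 / (l : ℝ)) * Cor22.logCondAvoid P {2, l})
          + 6 * l * ((l : ℝ) + 5) / (((l : ℝ) + 4) * ((l : ℝ) - 3)) * Real.log Real.pi < Cor22.logQAvoid P {2, l}) →
      ∀ T : Cor22.ThetaVolumeDatumAt P l,
        (letI := T.instFieldF; letI := T.instNumberFieldF; letI := T.instAlgebraF; letI := T.instFieldK
         letI := T.instNumberFieldK; letI := T.instAlgebraK; letI := T.instFieldFbar; letI := T.instAlgebraFbar
         letI := T.instAlgebraKFbar; letI := T.instIsElliptic
         ¬ (∀ p ∈ T.I.supportPrimes, ∀ v w : placesOver (fieldOfModuli T.E) p,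
            (Summit.ABC.IUTFork.DHData.ofInput T.I).logQloc p v = (Summit.ABC.IUTFork.DHData.ofInput T.I).logQloc p w)) →
        T.HullEstimateOf
          (((l : ℝ) + 1) / 4 *
            ((1 + 12 * (Cor22.dmod P : ℝ) / l) * (P.logDiff + Cor22.logCondAvoid P {2, l})
              + 2 * Real.log l + 52
              + 20 / 3 * Real.log (((2 ^ 12 * 3 ^ 3 * 5 * Cor22.dmod P : ℕ) : ℝ) * (l : ℝ))
                * (Nat.primeCounting (2 ^ 12 * 3 ^ 3 * 5 * Cor22.dmod P * l) : ℝ)))) := by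
  refine not_hregBad_of_sUnitFamily_szpiroBad hl h173 fun N => ?_
  obtain ⟨a, c, hNa, hla, hlc, hlo, hhi, hdisc⟩ := H (N + l + 1)
  have ha1 : 1 ≤ a := by omega
  have hc1 : 1 ≤ c := by
    by_contra h0
    have hc0 : c = 0 := by omega
    rw [hc0, pow_zero, mul_one] at hhi
    have := (Nat.pow_le_pow_iff_right (by norm_num : 1 < 5)).mp hhi
    omega
  exact ⟨a, c, by omega, hla, hlc, hlo, hhi, SUnitFamily.szpiroBad_of_log_discr_le ha1 hc1 hl (by omega) hhi hdisc⟩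

/-- **`hregBad` IMPLIES EVENTUAL SZPIRO-GOODNESS OF THE S-UNIT FAMILY (C-R42: the obstruction is Szpiro-type, certified).** For a prime `l ≥ 173`:
if the cone binder `hregBad` (VERBATIM) holds, then beyond some `N` NO member `(P_{a,c}, l)` (`a ≥ N`, `l ∤ a, c`, `7^c ≤ 5^a ≤ 5^l·7^c`) satisfies
the Szpiro-bad disjunct — `hregBad` contains an effective Szpiro-type inequality «`log q^{∤{2,l}} ≤ 6l/(l+4)·(log-diff + (1−1/l)·log-cond) + …`» for
an explicit infinite family of admissible `d_mod = 2` points of unbounded height. Contrapositive of `not_hregBad_of_sUnitFamily_szpiroBad`; nothing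
asserted about either side. [cite: Mochizuki2012, IUTchIV Thm. 1.10 proof Steps (v)-(viii) p. 27–31] [claim: Mochizuki2012, status: disputed] -/
theorem szpiroGood_eventually_of_hregBad {l : ℕ} (hl : l.Prime) (h173 : 173 ≤ l)
    (hregBad : (∀ P : NFPoint, P ∈ UP → ∀ l : ℕ, l.Prime → 5 ≤ l →
      Cor22.AdmitsCore P → Cor22.CondP2 P l → Cor22.CondP5 P l → Cor22.CondP6 P l →
      (((l : ℝ) + 5) / 4 < (Cor22.dmod P : ℝ) ∨
        6 * l * (((l : ℝ) + 5) - 4 * Cor22.dmod P) / (((l : ℝ) + 4) * ((l : ℝ) - 3))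
            * (P.logDiff + (1 - 1 / (l : ℝ)) * Cor22.logCondAvoid P {2, l})
          + 6 * l * ((l : ℝ) + 5) / (((l : ℝ) + 4) * ((l : ℝ) - 3)) * Real.log Real.pi < Cor22.logQAvoid P {2, l}) →
      ∀ T : Cor22.ThetaVolumeDatumAt P l,
        (letI := T.instFieldF; letI := T.instNumberFieldF; letI := T.instAlgebraF; letI := T.instFieldK
         letI := T.instNumberFieldK; letI := T.instAlgebraK; letI := T.instFieldFbar; letI := T.instAlgebraFbar
         letI := T.instAlgebraKFbar; letI := T.instIsElliptic
         ¬ (∀ p ∈ T.I.supportPrimes, ∀ v w : placesOver (fieldOfModuli T.E) p,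
            (Summit.ABC.IUTFork.DHData.ofInput T.I).logQloc p v = (Summit.ABC.IUTFork.DHData.ofInput T.I).logQloc p w)) →
        T.HullEstimateOf
          (((l : ℝ) + 1) / 4 *
            ((1 + 12 * (Cor22.dmod P : ℝ) / l) * (P.logDiff + Cor22.logCondAvoid P {2, l})
              + 2 * Real.log l + 52
              + 20 / 3 * Real.log (((2 ^ 12 * 3 ^ 3 * 5 * Cor22.dmod P : ℕ) : ℝ) * (l : ℝ))
                * (Nat.primeCounting (2 ^ 12 * 3 ^ 3 * 5 * Cor22.dmod P * l) : ℝ))))) :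
    ∃ N : ℕ, ∀ a c : ℕ, N ≤ a → ¬ l ∣ a → ¬ l ∣ c → 7 ^ c ≤ 5 ^ a → 5 ^ a ≤ 5 ^ l * 7 ^ c →
      ¬ (((l : ℝ) + 5) / 4 < (Cor22.dmod (SUnitFamily.Pt a c) : ℝ) ∨
        6 * l * (((l : ℝ) + 5) - 4 * Cor22.dmod (SUnitFamily.Pt a c)) / (((l : ℝ) + 4) * ((l : ℝ) - 3))
            * ((SUnitFamily.Pt a c).logDiff + (1 - 1 / (l : ℝ)) * Cor22.logCondAvoid (SUnitFamily.Pt a c) {2, l})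
          + 6 * l * ((l : ℝ) + 5) / (((l : ℝ) + 4) * ((l : ℝ) - 3)) * Real.log Real.pi <
          Cor22.logQAvoid (SUnitFamily.Pt a c) {2, l}) := by
  by_contra hne
  push Not at hne
  exact not_hregBad_of_sUnitFamily_szpiroBad hl h173 hne hregBad

/-- **`hregBad` IMPLIES AN abc-TYPE LOWER BOUND FOR THE DISCRIMINANTS `disc ℚ(√(5^{2a} + 4·7^{2c}))` (C-R42, arithmetic form).** For a prime
`l ≥ 173`: if `hregBad` (VERBATIM) holds, then for all large `a` with `l ∤ a, c`, `7^c ≤ 5^a ≤ 5^l·7^c`: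
`log|disc ℚ(√(5^{2a} + 4·7^{2c}))| > (1 + 4/l)·a·log 5 − (2(l+4)/3·log 5 + log 5 + 2·log 7 + 8)`, i.e. the squarefree kernel of
`D = 5^{2a} + 4·7^{2c}` exceeds `≈ √D·D^{2/l}/C(l)` — a statement of abc type about the `ℤ`-triples `5^{2a} + 4·7^{2c} = D` which the tree can
neither prove nor refute: THIS is the residue of TARGET #1 on the family, certified Szpiro-type in the kernel. Contrapositive of
`not_hregBad_of_sUnitFamily_powerful`. [cite: MochizukiGenEll2010, Def 1.5 (iii) p.8] [claim: Mochizuki2012, status: disputed] -/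
theorem lt_log_discr_eventually_of_hregBad {l : ℕ} (hl : l.Prime) (h173 : 173 ≤ l)
    (hregBad : (∀ P : NFPoint, P ∈ UP → ∀ l : ℕ, l.Prime → 5 ≤ l →
      Cor22.AdmitsCore P → Cor22.CondP2 P l → Cor22.CondP5 P l → Cor22.CondP6 P l →
      (((l : ℝ) + 5) / 4 < (Cor22.dmod P : ℝ) ∨
        6 * l * (((l : ℝ) + 5) - 4 * Cor22.dmod P) / (((l : ℝ) + 4) * ((l : ℝ) - 3))
            * (P.logDiff + (1 - 1 / (l : ℝ)) * Cor22.logCondAvoid P {2, l})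
          + 6 * l * ((l : ℝ) + 5) / (((l : ℝ) + 4) * ((l : ℝ) - 3)) * Real.log Real.pi < Cor22.logQAvoid P {2, l}) →
      ∀ T : Cor22.ThetaVolumeDatumAt P l,
        (letI := T.instFieldF; letI := T.instNumberFieldF; letI := T.instAlgebraF; letI := T.instFieldK
         letI := T.instNumberFieldK; letI := T.instAlgebraK; letI := T.instFieldFbar; letI := T.instAlgebraFbar
         letI := T.instAlgebraKFbar; letI := T.instIsElliptic
         ¬ (∀ p ∈ T.I.supportPrimes, ∀ v w : placesOver (fieldOfModuli T.E) p,
            (Summit.ABC.IUTFork.DHData.ofInput T.I).logQloc p v = (Summit.ABC.IUTFork.DHData.ofInput T.I).logQloc p w)) →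
        T.HullEstimateOf
          (((l : ℝ) + 1) / 4 *
            ((1 + 12 * (Cor22.dmod P : ℝ) / l) * (P.logDiff + Cor22.logCondAvoid P {2, l})
              + 2 * Real.log l + 52
              + 20 / 3 * Real.log (((2 ^ 12 * 3 ^ 3 * 5 * Cor22.dmod P : ℕ) : ℝ) * (l : ℝ))
                * (Nat.primeCounting (2 ^ 12 * 3 ^ 3 * 5 * Cor22.dmod P * l) : ℝ))))) :
    ∃ N : ℕ, ∀ a c : ℕ, N ≤ a → ¬ l ∣ a → ¬ l ∣ c → 7 ^ c ≤ 5 ^ a → 5 ^ a ≤ 5 ^ l * 7 ^ c →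
      (1 + 4 / (l : ℝ)) * ((a : ℝ) * Real.log 5) - (2 * ((l : ℝ) + 4) / 3 * Real.log 5 + (Real.log 5 + 2 * Real.log 7) + 8) <
        Real.log ((NumberField.discr (SUnitFamily.F a c)).natAbs : ℝ) := by
  by_contra hne
  push Not at hne
  exact not_hregBad_of_sUnitFamily_powerful hl h173 hne hregBad

end Conditional

end Summit.ABC.IUTFork

end
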